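import Summits.BirchSwinnertonDyer.BirchSwinnertonDyer.Theorems.AlignedTransportAtTwoMainConjectureOfRankZeroBSDAtTwoCubicDescentConicLocalLemma
import Literature.NumberTheory.QuadraticForms.PadicHilbertSymbol
import HarnessLib

/-!
# Route `AlignedTransportAtTwo`, crux C2 `MainConjectureOfRankZeroBSDAtTwo` (stmt-BirchSwinnertonDyer-22298):
# THE LOCAL DICTIONARY AT 2 OF THE CUBIC CHEVALLEY ROAD (ODD-BRANCH §6), BOTH HALVES, KERNEL:
# the model descent conic `⟨N(α)d⟩ ⊥ Tr(α m √d · y²)` of a unit `α = x + y√d ∈ ℤ₂[√d]^×` (`d ≡ 3 (mod 4)`, `m` odd) is insoluble over `ℚ₂`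
# EXACTLY in class D (`N(α) ≡ 5 (mod 8)` and `y` odd)

HONEST FRAMING (cell `bsd-f1-sign2`, WIDTH-5 attached prover seat `bsd-line-att-p5` gen 32 on line `birth` of the lead `bsd-line-att-p2`;
`--supports` stmt-BirchSwinnertonDyer-22298, closes nothing; BSD is NOT proved by any of this; the crux C2, its verdict «blocked-on
`Rank1Residual.GreenbergMuConjectureIrreducible`» and every registered stub are untouched). THEOREMS ONLY, pure `2`-adic arithmetic; nothing about
a particular curve. Companion of `…CubicDescentConicLocalLemma` (this gen: the anisotropic half by infinite descent).

WHAT. With `N = x² − dy²`, `Q(X, Y, Z) = N·d·X² + 2md·(y·Y² + 2x·Y·Z + y·d·Z²)` (written out literally in every statement):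
* §1 `descentConic_isotropic_of_emod_eight_eq_one`: `N ≡ 1 (mod 8)` (classes A and C) ⟹ `Q` has a non-trivial zero — `(0, r − x, y)` with `r² = N`
  in `ℚ₂` (the tree's `padic_isSquare_intCast_of_mod_eight`, Serre II.3.3 Thm 4), or `(0, 1, 0)` if `y = 0`; here `Q(0, r − x, y) = 2mdy·(r² − N)`.
* §2 `descentConic_isotropic_of_emod_eight_eq_five_of_even`: `N ≡ 5 (mod 8)` and `y` even (class B; then `y ≡ 2 (mod 4)`) ⟹ the zero `(2my, r − xm, my)`
  with `r² = N·m·(m − 2y)` (`≡ 5·5 ≡ 1 (mod 8)`); here `Q(2my, r − xm, my) = 2mdy·(r² − Nm(m − 2y))`.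
* §3 ★ `descentConic_isotropic_iff`: for `m` odd, `d ≡ 3 (mod 4)`, `N` odd: `Q` is ISOTROPIC over `ℚ₂` iff NOT (`N ≡ 5 (mod 8)` ∧ `y` odd) — the
  anisotropic direction is `…CubicDescentConicLocalLemma.descentConic_classD_anisotropic`. This is g31's «LOCAL DICTIONARY AT 2 (ramified `F`)»
  observed 275/275 (`ODD-BRANCH-att-p5-g31.md` §5 (1), §6), now a kernel theorem; with Cassels' reciprocity for conics and niceness at the odd places
  (print) it is the mechanism behind «the unit-sign door is VOID on `Δ_min ≡ 3, 7 (mod 8)`».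
Beyond-print theorem: no (dyadic Hilbert-symbol computation); new = the kernel dictionary keyed to the road. BSD is not proved; nothing closed.

References: [Serre1973] Ch. II §3.3 Thm 4, Ch. III §1.2 Thm 1; [Cassels1991] §3, §15; [YooYu2022] Thm 1.10, Lemma 4.12.
-/

set_option linter.dupNamespace false
set_option autoImplicit false

noncomputable section

namespace Summit.BirchSwinnertonDyer.BirchSwinnertonDyer.Theorems.AlignedTransportAtTwoCubicDescentConicLocalDictionary

open Summit.BirchSwinnertonDyer.BirchSwinnertonDyer.Theorems.AlignedTransportAtTwoCubicDescentConicLocalLemma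
  Literature.NumberTheory.QuadraticForms

/-! ## §0 Residues -/

/-- For `d ≡ 3 (mod 4)` an odd `x² − dy²` is `≡ 1` or `5 (mod 8)` (unit norms from the ramified `ℚ₂(√d)` are `≡ 1 (mod 4)`). [cite: Serre1973, Ch. II §3.3] -/
theorem norm_emod_eight_of_emod_four_eq_three {x y d : ℤ} (hd : d % 4 = 3) (hN : Odd (x ^ 2 - d * y ^ 2)) :
    (x ^ 2 - d * y ^ 2) % 8 = 1 ∨ (x ^ 2 - d * y ^ 2) % 8 = 5 := by
  have key : ∀ a b e : ZMod 8, (e = 3 ∨ e = 7) →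
      (a ^ 2 - e * b ^ 2 = 1 ∨ a ^ 2 - e * b ^ 2 = 3 ∨ a ^ 2 - e * b ^ 2 = 5 ∨ a ^ 2 - e * b ^ 2 = 7) →
      (a ^ 2 - e * b ^ 2 = 1 ∨ a ^ 2 - e * b ^ 2 = 5) := by
    decide
  have hc : ∀ z : ℤ, (z : ZMod 8) = ((z % 8 : ℤ) : ZMod 8) := fun z ↦ by simpa using (ZMod.intCast_mod z 8).symm
  have hd8 : (d : ZMod 8) = 3 ∨ (d : ZMod 8) = 7 := by
    have : d % 8 = 3 ∨ d % 8 = 7 := by omega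
    rw [hc d]; rcases this with h | h <;> rw [h] <;> decide
  have hN8 : (x ^ 2 - d * y ^ 2) % 8 = 1 ∨ (x ^ 2 - d * y ^ 2) % 8 = 3 ∨ (x ^ 2 - d * y ^ 2) % 8 = 5 ∨ (x ^ 2 - d * y ^ 2) % 8 = 7 := by
    obtain ⟨k, hk⟩ := hN; omega
  have hcast : (((x ^ 2 - d * y ^ 2 : ℤ)) : ZMod 8) = (x : ZMod 8) ^ 2 - (d : ZMod 8) * (y : ZMod 8) ^ 2 := by push_cast; ring
  have hN8' : (x : ZMod 8) ^ 2 - (d : ZMod 8) * (y : ZMod 8) ^ 2 = 1 ∨ (x : ZMod 8) ^ 2 - (d : ZMod 8) * (y : ZMod 8) ^ 2 = 3 ∨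
      (x : ZMod 8) ^ 2 - (d : ZMod 8) * (y : ZMod 8) ^ 2 = 5 ∨ (x : ZMod 8) ^ 2 - (d : ZMod 8) * (y : ZMod 8) ^ 2 = 7 := by
    rw [← hcast, hc]; rcases hN8 with h | h | h | h <;> rw [h] <;> decide
  rcases key _ _ _ hd8 hN8' with h | h
  · left; rw [← hcast, hc] at h
    rcases hN8 with h' | h' | h' | h' <;> rw [h'] at h <;> first | exact h' | exact absurd h (by decide)
  · right; rw [← hcast, hc] at h
    rcases hN8 with h' | h' | h' | h' <;> rw [h'] at h <;> first | exact h' | exact absurd h (by decide)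

/-- `N = x² − dy² ≡ 5 (mod 8)` with `y` even forces `y ≡ 2 (mod 4)` (if `4 ∣ y` then `N ≡ x² ≢ 5`). [cite: Serre1973, Ch. II §3.3] -/
theorem emod_four_eq_two_of_even_of_norm_emod_eight_eq_five {x y d : ℤ} (hy : Even y) (hN : (x ^ 2 - d * y ^ 2) % 8 = 5) :
    y % 4 = 2 := by
  have key : ∀ a b e : ZMod 8, a ^ 2 - e * b ^ 2 = 5 → (b = 0 ∨ b = 2 ∨ b = 4 ∨ b = 6) → (b = 2 ∨ b = 6) := by decide
  have hc : ∀ z : ℤ, (z : ZMod 8) = ((z % 8 : ℤ) : ZMod 8) := fun z ↦ by simpa using (ZMod.intCast_mod z 8).symm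
  have hy8 : y % 8 = 0 ∨ y % 8 = 2 ∨ y % 8 = 4 ∨ y % 8 = 6 := by obtain ⟨k, hk⟩ := hy; omega
  have hyz : (y : ZMod 8) = 0 ∨ (y : ZMod 8) = 2 ∨ (y : ZMod 8) = 4 ∨ (y : ZMod 8) = 6 := by
    rw [hc y]; rcases hy8 with h | h | h | h <;> rw [h] <;> decide
  have hN8 : (x : ZMod 8) ^ 2 - (d : ZMod 8) * (y : ZMod 8) ^ 2 = 5 := by
    have : (((x ^ 2 - d * y ^ 2 : ℤ)) : ZMod 8) = 5 := by rw [hc, hN]; decide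
    push_cast at this; exact this
  rcases key _ _ _ hN8 hyz with h | h
  · rw [hc y] at h; rcases hy8 with h' | h' | h' | h' <;> rw [h'] at h <;> first | omega | exact absurd h (by decide)
  · rw [hc y] at h; rcases hy8 with h' | h' | h' | h' <;> rw [h'] at h <;> first | omega | exact absurd h (by decide)

/-- `N ≡ 5 (mod 8)` and `y` even give `N·m·(m − 2y) ≡ 1 (mod 8)` for odd `m` (`m(m − 2y) ≡ m(m + 4) ≡ 5`). [cite: Serre1973, Ch. II §3.3] -/
theorem witness_emod_eight_eq_one {x y d m : ℤ} (hm : Odd m) (hy : Even y) (hN : (x ^ 2 - d * y ^ 2) % 8 = 5) :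
    ((x ^ 2 - d * y ^ 2) * m * (m - 2 * y)) % 8 = 1 := by
  have hy4 := emod_four_eq_two_of_even_of_norm_emod_eight_eq_five hy hN
  have key : ∀ n a b : ZMod 8, n = 5 → (a = 1 ∨ a = 3 ∨ a = 5 ∨ a = 7) → (b = 2 ∨ b = 6) → n * a * (a - 2 * b) = 1 := by decide
  have hc : ∀ z : ℤ, (z : ZMod 8) = ((z % 8 : ℤ) : ZMod 8) := fun z ↦ by simpa using (ZMod.intCast_mod z 8).symm
  have hm8 : (m : ZMod 8) = 1 ∨ (m : ZMod 8) = 3 ∨ (m : ZMod 8) = 5 ∨ (m : ZMod 8) = 7 := by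
    have : m % 8 = 1 ∨ m % 8 = 3 ∨ m % 8 = 5 ∨ m % 8 = 7 := by obtain ⟨k, hk⟩ := hm; omega
    rw [hc m]; rcases this with h | h | h | h <;> rw [h] <;> decide
  have hy8 : (y : ZMod 8) = 2 ∨ (y : ZMod 8) = 6 := by
    have : y % 8 = 2 ∨ y % 8 = 6 := by omega
    rw [hc y]; rcases this with h | h <;> rw [h] <;> decide
  have hN8 : (((x ^ 2 - d * y ^ 2 : ℤ)) : ZMod 8) = 5 := by rw [hc, hN]; decide
  have h8 : ((((x ^ 2 - d * y ^ 2) * m * (m - 2 * y) : ℤ)) : ZMod 8) = ((1 : ℤ) : ZMod 8) := by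
    have := key _ _ _ hN8 hm8 hy8
    push_cast at this ⊢
    linear_combination this
  rw [ZMod.intCast_eq_intCast_iff'] at h8
  norm_num at h8
  exact h8

/-! ## §1 Classes A and C: `N ≡ 1 (mod 8)` ⟹ isotropic -/

/-- **`N = x² − dy² ≡ 1 (mod 8)` ⟹ the model conic has a non-trivial zero over `ℚ₂`**: `√N ∈ ℚ₂` (Serre II.3.3 Thm 4) and
`Q(0, r − x, y) = 2mdy·(r² − N)`; for `y = 0` the zero `(0, 1, 0)`. [cite: Serre1973, Ch. II §3.3 Thm 4] -/
theorem descentConic_isotropic_of_emod_eight_eq_one {x y d m : ℤ} (hN : (x ^ 2 - d * y ^ 2) % 8 = 1) :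
    ∃ X Y Z : ℚ_[2], (X ≠ 0 ∨ Y ≠ 0 ∨ Z ≠ 0) ∧
      ((x ^ 2 - d * y ^ 2 : ℤ) : ℚ_[2]) * d * X ^ 2 + 2 * m * d * (y * Y ^ 2 + 2 * x * Y * Z + y * d * Z ^ 2) = 0 := by
  by_cases hy : y = 0
  · refine ⟨0, 1, 0, Or.inr (Or.inl one_ne_zero), ?_⟩
    subst hy; push_cast; ring
  · obtain ⟨r, hr⟩ := padic_isSquare_intCast_of_mod_eight (p := 2) rfl hN
    have hy0 : (y : ℚ_[2]) ≠ 0 := by exact_mod_cast hy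
    refine ⟨0, r - x, y, Or.inr (Or.inr hy0), ?_⟩
    push_cast at hr ⊢
    linear_combination (-(2 * m * d * y : ℚ_[2])) * hr

/-! ## §2 Class B: `N ≡ 5 (mod 8)`, `y` even ⟹ isotropic -/

/-- **`N ≡ 5 (mod 8)` and `y` even (class B) ⟹ the model conic has a non-trivial zero over `ℚ₂`** (for odd `m`): `y ≡ 2 (mod 4)`, so
`N·m·(m − 2y) ≡ 1 (mod 8)` is a square `r²` in `ℚ₂`, and `Q(2my, r − xm, my) = 2mdy·(r² − Nm(m − 2y)) = 0` with `2my ≠ 0`.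
[cite: Serre1973, Ch. II §3.3 Thm 4] -/
theorem descentConic_isotropic_of_emod_eight_eq_five_of_even {x y d m : ℤ} (hm : Odd m) (hy : Even y)
    (hN : (x ^ 2 - d * y ^ 2) % 8 = 5) :
    ∃ X Y Z : ℚ_[2], (X ≠ 0 ∨ Y ≠ 0 ∨ Z ≠ 0) ∧
      ((x ^ 2 - d * y ^ 2 : ℤ) : ℚ_[2]) * d * X ^ 2 + 2 * m * d * (y * Y ^ 2 + 2 * x * Y * Z + y * d * Z ^ 2) = 0 := by
  obtain ⟨r, hr⟩ := padic_isSquare_intCast_of_mod_eight (p := 2) rfl (witness_emod_eight_eq_one hm hy hN)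
  have hm0' : m ≠ 0 := by rintro rfl; exact (by decide : ¬ Odd (0 : ℤ)) hm
  have hy0' : y ≠ 0 := by have := emod_four_eq_two_of_even_of_norm_emod_eight_eq_five hy hN; omega
  have hm0 : (m : ℚ_[2]) ≠ 0 := by exact_mod_cast hm0'
  have hy0 : (y : ℚ_[2]) ≠ 0 := by exact_mod_cast hy0'
  refine ⟨2 * m * y, r - x * m, m * y, Or.inl (mul_ne_zero (mul_ne_zero two_ne_zero hm0) hy0), ?_⟩
  push_cast at hr ⊢
  linear_combination (-(2 * m * d * y : ℚ_[2])) * hr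

/-! ## §3 The dictionary -/

/-- ★ **THE LOCAL DICTIONARY AT 2 (ramified `F = ℚ₂(√d)`, `d ≡ 3 (mod 4)`).** For integers `x, y, d, m` with `m` odd, `d ≡ 3 (mod 4)` and
`N = x² − dy²` odd (a unit `α = x + y√d` of `ℤ₂[√d]`), the model descent conic
`Q = N·d·X² + 2md·(y·Y² + 2x·Y·Z + y·d·Z²)` (`= ⟨N(α)d⟩ ⊥ Tr_{F/ℚ₂}(α m √d (Y + Z√d)²)`) HAS A NON-TRIVIAL ZERO OVER `ℚ₂` IFF NOT
(`N ≡ 5 (mod 8)` AND `y` odd) — i.e. iff `α` is not in CLASS D. (`⇐`: §1–§2; `⇒`: `descentConic_classD_anisotropic`.) This is the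
dictionary «`S_η(ℚ₂) = ∅ ⟺ η ∈ D`» of `ODD-BRANCH-att-p5-g31.md` §5 (1)/§6 (observed 275/275), in the kernel.
[cite: Serre1973, Ch. II §3.3 Thm 4 and Ch. III §1.2 Thm 1] [cite: Cassels1991, §15 (pp. 66–72)] -/
theorem descentConic_isotropic_iff {x y d m : ℤ} (hm : Odd m) (hd : d % 4 = 3) (hNodd : Odd (x ^ 2 - d * y ^ 2)) :
    (∃ X Y Z : ℚ_[2], (X ≠ 0 ∨ Y ≠ 0 ∨ Z ≠ 0) ∧
      ((x ^ 2 - d * y ^ 2 : ℤ) : ℚ_[2]) * d * X ^ 2 + 2 * m * d * (y * Y ^ 2 + 2 * x * Y * Z + y * d * Z ^ 2) = 0) ↔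
    ¬ ((x ^ 2 - d * y ^ 2) % 8 = 5 ∧ Odd y) := by
  have hdodd : Odd d := by rw [Int.odd_iff]; omega
  rcases norm_emod_eight_of_emod_four_eq_three hd hNodd with h1 | h5
  · refine ⟨fun _ ↦ by omega, fun _ ↦ descentConic_isotropic_of_emod_eight_eq_one h1⟩
  · rcases Int.even_or_odd y with hye | hyo
    · exact ⟨fun _ ↦ fun h ↦ (Int.not_odd_iff_even.mpr hye) h.2,
        fun _ ↦ descentConic_isotropic_of_emod_eight_eq_five_of_even hm hye h5⟩
    · constructor
      · rintro ⟨X, Y, Z, hne, hQ⟩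
        obtain ⟨hX, hY, hZ⟩ := descentConic_classD_anisotropic hyo hm hdodd h5 X Y Z hQ
        exfalso; rcases hne with h | h | h <;> exact h (by assumption)
      · exact fun h ↦ absurd ⟨h5, hyo⟩ h

/-- **CLASS-D form of the dictionary**: under the same hypotheses, `Q` is ANISOTROPIC over `ℚ₂` iff `N ≡ 5 (mod 8)` and `y` is odd.
[cite: Serre1973, Ch. III §1.2 Thm 1] -/
theorem descentConic_anisotropic_iff_classD {x y d m : ℤ} (hm : Odd m) (hd : d % 4 = 3) (hNodd : Odd (x ^ 2 - d * y ^ 2)) :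
    (∀ X Y Z : ℚ_[2], ((x ^ 2 - d * y ^ 2 : ℤ) : ℚ_[2]) * d * X ^ 2 + 2 * m * d * (y * Y ^ 2 + 2 * x * Y * Z + y * d * Z ^ 2) = 0 →
        X = 0 ∧ Y = 0 ∧ Z = 0) ↔ ((x ^ 2 - d * y ^ 2) % 8 = 5 ∧ Odd y) := by
  have h := descentConic_isotropic_iff hm hd hNodd
  constructor
  · intro hall
    by_contra hD
    obtain ⟨X, Y, Z, hne, hQ⟩ := h.mpr hD
    obtain ⟨hX, hY, hZ⟩ := hall X Y Z hQ
    rcases hne with h' | h' | h' <;> exact h' (by assumption)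
  · rintro ⟨h5, hyo⟩ X Y Z hQ
    exact descentConic_classD_anisotropic hyo hm (by rw [Int.odd_iff]; omega) h5 X Y Z hQ

end Summit.BirchSwinnertonDyer.BirchSwinnertonDyer.Theorems.AlignedTransportAtTwoCubicDescentConicLocalDictionary

end
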